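import Summits.QuantumFields.YangMills.Theses.TransportPerturbation
import Summits.QuantumFields.YangMills.Theorems.ColdStartUniversalityColdStartSolutionsExistNoise

/-!
# Route `TransportPerturbation` — support `SolutionFamily` (stmt-QuantumFields-26920) FROM the named fact
# `LatticeLangevinMeasurableFlow` (Kunita / SZZ Lemma 3.2) on the product Wiener space

Seat `ym-line-sfw-p1` g12 (2026-08-28).  Rung R3 is a RECORD-label rung (leaf `YM3TorusSU2`), not the Clay mass gap; this module is
bookkeeping and proves no step of any renormalisation-group argument.

`SolutionFamily` asks, for every family `F`, `γ > 0` and step `K`, for SOME probability space carrying a flat Brownian motion and a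
family `x ↦ V x` of strong solutions of the step-`K` SZZ lattice Langevin dynamics (`SU(2)`, fundamental representation, inverse coupling
`(γ ε_K)⁻¹/2`) with `V x 0 = x`, jointly measurable in (start, `ω`) at every time.  THIS FILE: the CONDITIONAL closure
`solutionFamily_of_measurableFlow : (∀ L β, LatticeLangevinMeasurableFlow r 3 L β) → SolutionFamily` — the probability space is the
product Wiener space over the links of Bałaban's `K`-th lattice with its coordinate flat Brownian driver (route `ColdStartUniversality`,
`isFlatBrownian_piWiener`, `isProbabilityMeasure_piWiener`), the scope hypothesis `IsClassicalDefining` is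
`LatticeRep.isClassicalDefining_specialUnitaryGroup 2`, and the measurable flow is the named fact verbatim.  The named fact (a jointly
measurable version of the strong solutions from all starts, [Kunita1984] Ch. II Thm 2.2 applied to SZZ (⋆)) is NOT proved here, so this is
a `conditional-result` and does not close the item.  No definitions, no `sorry`.
-/

set_option autoImplicit false

noncomputable section

open MeasureTheory
open scoped NNReal
open Literature.MathematicalPhysics.QuantumFieldTheory
open Literature.MathematicalPhysics.QuantumFieldTheory.Balaban1983to89
open Literature.MathematicalPhysics.QuantumLattice (fundamentalRep continuous_fundamentalRep fundamentalRep_injective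
  fundamentalRep_mem_unitaryGroup)
open Literature.Probability.Process

namespace Summit.QuantumFields.YangMills.Theorems.TransportPerturbation

/-- ★ **`SolutionFamily` from the named fact `LatticeLangevinMeasurableFlow`** (Kunita's jointly measurable version of the SZZ strong
solutions, for `SU(2)` in its fundamental representation, every torus size and every inverse coupling): CONDITIONAL closure of
stmt-QuantumFields-26920 on the product Wiener space `((Edge 3 N_K × NoiseIdx 2) → C(ℝ≥0))` with its coordinate flat Brownian driver.
[cite: Kunita1984, Ch. II §2 Thm 2.2 (LNM 1097, p. 188)] [cite: ShenZhuZhu2022, §3 Lemma 3.2 (p. 13)] -/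
theorem solutionFamily_of_measurableFlow
    (hFlow : ∀ (L : ℕ) [NeZero L] (β : ℝ),
      LatticeLangevinMeasurableFlow (G := Matrix.specialUnitaryGroup (Fin 2) ℂ)
        (⟨2, fundamentalRep (Fin 2), continuous_fundamentalRep _, fundamentalRep_injective _, fundamentalRep_mem_unitaryGroup⟩ :
          LatticeRep (Matrix.specialUnitaryGroup (Fin 2) ℂ)) 3 L β) :
    Summit.QuantumFields.YangMills.Theses.TransportPerturbation.SolutionFamily := by
  intro F γ _hγ K
  haveI := ColdStartUniversality.isProbabilityMeasure_piWiener (Edge 3 ((F.P K).sitesPerDir 0) × NoiseIdx 2)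
  have hW := ColdStartUniversality.isFlatBrownian_piWiener 3 ((F.P K).sitesPerDir 0) (NoiseIdx 2)
  have hscope := LatticeRep.isClassicalDefining_specialUnitaryGroup 2
  obtain ⟨U, hU, hmeas⟩ := hFlow ((F.P K).sitesPerDir 0) ((γ * (F.P K).eps)⁻¹ / 2) hscope _
    (Measure.pi fun _ : Edge 3 ((F.P K).sitesPerDir 0) × NoiseIdx 2 => preWienerMeasure) _ hW
  exact ⟨_, inferInstance, _, inferInstance, _, hW, U, hU, hmeas⟩

end Summit.QuantumFields.YangMills.Theorems.TransportPerturbation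

end
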